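import Literature.Geometry.Riemannian.GurskyViaclovskyClosednessBootstrap
import Literature.Geometry.Riemannian.GurskyViaclovskyClosednessEKOperator
import Literature.Geometry.Riemannian.GurskyViaclovskyClosednessEKBounds
import Literature.Geometry.Riemannian.GurskyViaclovskyClosednessEKGlue
import Literature.Analysis.PDE.EvansKrylovInterior
import HarnessLib

/-!
# Gursky–Viaclovsky closedness: the Evans–Krylov estimate in the charts, and the named fact

Support file (everything PROVED; no definition, no named fact left assumed) for the named fact
`Literature.Geometry.Riemannian.gurskyViaclovsky_pathClosed_weighted_four`
(Gursky–Viaclovsky, J. Differential Geom. 63 (2003), Prop. 6 and §5: the solvable set of the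
Weyl-weighted `σ₂` continuity path is closed). `GurskyViaclovskyClosednessBootstrap.lean` reduced
the fact to the interior Evans–Krylov `C^{2,α}` estimate of the chart representatives of
`C²`-bounded sequences of smooth admissible solutions (`pathClosed_of_chartC2alphaBounds`). This
file supplies that estimate from the abstract a-priori form of Gilbarg–Trudinger's Theorem 17.14
(`Literature.Analysis.PDE.EvansKrylov.evansKrylov_interior_holder`) applied to the concave
(`σ₂^{1/2}`) form of the chart equation (`ekOperator`):

* `chart_holderOnWith_two` — on a closed Riemannian `4`-manifold, for a `C²`-bounded sequence of
  smooth admissible solutions of `backgroundPathOperator g s_k (−u_k) = q e^{4u_k}`, `s_k → t`,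
  `s_k ≤ 1`, every point `c` has a chart ball on which the second derivatives of the
  representatives `u_k ∘ (chartAt c)⁻¹` are `α`-Hölder uniformly in `k`: the jet function
  `ekOperator G W Q ψ` (with `ψ` the smooth square-root cutoff `exists_smooth_sqrt_cutoff` at the
  uniform admissibility margin) is smooth (`contDiffOn_ekOperator`), vanishes along the solutions
  (`ekOperator_cjetOf_eq_zero`), is uniformly elliptic with constants depending only on
  `(min q, C, sup|Ric|, sup|R|, sup|s_k|)` and the chart (`ekOperator_symbol_bounds_of_solution`),
  has uniformly bounded first and second derivatives on the relevant compact jet sets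
  (`exists_ekOperator_deriv_bounds`), is concave in the top slot at the solutions' jets
  (`fderiv_fderiv_ekOperator_nonpos_of_solution`) and satisfies the supporting-hyperplane
  inequality at the hybrid jets within the uniform margin radius
  (`ekOperator_hybrid_sub_le_of_solution`, `exists_hybrid_margin_uniform`); the chart `C²` bounds
  are `chart_iteratedFDeriv_bounds_le_two`;
* `gurskyViaclovsky_pathClosed_weighted_four_holds` — **the named fact holds**
  (`pathClosed_of_chartC2alphaBounds`).

## References

* M. J. Gursky, J. A. Viaclovsky, J. Differential Geom. 63 (2003) 131–154, Prop. 6, §5.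
  [GurskyViaclovsky2003]
* D. Gilbarg, N. S. Trudinger, *Elliptic Partial Differential Equations of Second Order* (2001),
  §17.4, Thm. 17.14. [GilbargTrudinger2001]
-/

noncomputable section

set_option maxSynthPendingDepth 3

open scoped Manifold ContDiff Topology NNReal
open Set Filter Metric Function Module

namespace Literature.Geometry.Riemannian.GurskyViaclovskyPath

open Literature.Geometry.Lorentzian (PseudoRiemannianMetric)
open Literature.Geometry.Lorentzian.PseudoRiemannianMetric
open Literature.Geometry.Lorentzian
open Literature.Geometry.Lorentzian.MetricCoord
open Literature.Geometry.Riemannian.GurskyViaclovsky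
open Literature.Analysis.Calculus Literature.Analysis.PDE Literature.Analysis.PDE.EvansKrylov

/-! ### The Evans–Krylov estimate in a chart -/

section Chart

variable {M : Type*} [TopologicalSpace M] [ChartedSpace (EuclideanSpace ℝ (Fin 4)) M]
  [IsManifold (𝓡 4) ∞ M]
  (g : PseudoRiemannianMetric (𝓡 4) ∞ (EuclideanSpace ℝ (Fin 4)) (TangentSpace (𝓡 4) : M → Type _))
  [g.HasLeviCivita]

/-- **The interior Evans–Krylov estimate in a chart** (Gursky–Viaclovsky's Prop. 6: "the `C²`
estimate implies uniform ellipticity, and the `C^{2,α}` estimate then follows from the work of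
[Krylov] and [Evans]"; Gilbarg–Trudinger Thm. 17.14 for the concave operator
`σ₂^{1/2}(A^t_U) − (¼(q e^{4U} + ¼|W|²))^{1/2}` in the chart). On a closed Riemannian `4`-manifold
let `u_k` be smooth with `backgroundPathOperator g s_k (−u_k) = q e^{4u_k}` (`q > 0` smooth),
`backgroundScalar g (−u_k) > 0`, `s_k → t`, `s_k ≤ 1`, and `|u_k|, |∇u_k|²_g, |∇²u_k|²_g ≤ C`.
Then every point `c` has a chart ball inside the chart target on which the second derivatives of
the representatives `u_k ∘ (chartAt c)⁻¹` are `α`-Hölder, `0 < α < 1`, with one constant for all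
`k`. [cite: GurskyViaclovsky2003, Prop. 6; GilbargTrudinger2001, Theorem 17.14] -/
theorem chart_holderOnWith_two [CompactSpace M] (hg : g.IsRiemannian)
    {q : M → ℝ} {C : ℝ} (hq : ContMDiff (𝓡 4) 𝓘(ℝ) ∞ q) (hq0 : ∀ x, 0 < q x) {s : ℕ → ℝ} {t : ℝ}
    (hs : Tendsto s atTop (𝓝 t)) (hs1 : ∀ k, s k ≤ 1) {u : ℕ → M → ℝ}
    (hu : ∀ k, ContMDiff (𝓡 4) 𝓘(ℝ) ∞ (u k))
    (heq : ∀ k x, backgroundPathOperator g (s k) (fun y ↦ -u k y) x =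
      q x * Real.exp (-4 * (-u k x)))
    (hpos : ∀ k x, 0 < backgroundScalar g (fun y ↦ -u k y) x)
    (hbd : ∀ k x, |u k x| ≤ C ∧ g.gradSq (u k) x ≤ C ∧ g.normSq x (g.hessian (u k) x) ≤ C)
    (c : M) :
    ∃ r : ℝ, 0 < r ∧
      ball (chartAt (EuclideanSpace ℝ (Fin 4)) c c) r ⊆
        (chartAt (EuclideanSpace ℝ (Fin 4)) c).target ∧
      ∃ α : ℝ≥0, 0 < α ∧ α < 1 ∧ ∃ B : ℝ≥0, ∀ k,
        HolderOnWith B α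
          (iteratedFDeriv ℝ 2 (fun z ↦ u k ((chartAt (EuclideanSpace ℝ (Fin 4)) c).symm z)))
          (ball (chartAt (EuclideanSpace ℝ (Fin 4)) c c) r) := by
  classical
  -- the inverse chart at `c` and the pulled-back metric
  set U : TopologicalSpace.Opens (EuclideanSpace ℝ (Fin 4)) :=
    ⟨(chartAt (EuclideanSpace ℝ (Fin 4)) c).target,
      (chartAt (EuclideanSpace ℝ (Fin 4)) c).open_target⟩
  set Φ : U → M := fun u ↦ (chartAt (EuclideanSpace ℝ (Fin 4)) c).symm u
  have hΦ : ContMDiff 𝓘(ℝ, EuclideanSpace ℝ (Fin 4)) 𝓘(ℝ, EuclideanSpace ℝ (Fin 4)) (∞ + 1) Φ :=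
    ChartInverseSelf.contMDiff_symm c
  have hΦ' : ∀ u, Function.Injective
      (mfderiv 𝓘(ℝ, EuclideanSpace ℝ (Fin 4)) 𝓘(ℝ, EuclideanSpace ℝ (Fin 4)) Φ u) :=
    ChartInverseSelf.injective_mfderiv_symm c
  have hdim : Module.finrank ℝ (EuclideanSpace ℝ (Fin 4)) =
      Module.finrank ℝ (EuclideanSpace ℝ (Fin 4)) := rfl
  have hE : finrank ℝ (EuclideanSpace ℝ (Fin 4)) = 4 := finrank_euclideanSpace_fin
  have hpb : contMDiff_pullbackBilin 𝓘(ℝ, EuclideanSpace ℝ (Fin 4)) M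
      𝓘(ℝ, EuclideanSpace ℝ (Fin 4)) U ∞ := contMDiff_pullbackBilin_holds
  set gU := g.comap hpb Φ hΦ hΦ' hdim
  haveI : gU.HasLeviCivita := gU.hasLeviCivita
  set G : EuclideanSpace ℝ (Fin 4) →
      EuclideanSpace ℝ (Fin 4) →L[ℝ] EuclideanSpace ℝ (Fin 4) →L[ℝ] ℝ :=
    Function.extend (Subtype.val : U → EuclideanSpace ℝ (Fin 4))
      (fun y : U ↦ (gU.val y :
        EuclideanSpace ℝ (Fin 4) →L[ℝ] EuclideanSpace ℝ (Fin 4) →L[ℝ] ℝ)) (fun _ ↦ 0) with hGdef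
  have hG : ∀ y : U, gU.val y = G y := fun y ↦ by
    rw [hGdef, Subtype.val_injective.extend_apply]
  have hgUR : gU.IsRiemannian := fun z v hv ↦ by
    have h1 : gU.val z v v = g.val (Φ z)
        (mfderiv 𝓘(ℝ, EuclideanSpace ℝ (Fin 4)) 𝓘(ℝ, EuclideanSpace ℝ (Fin 4)) Φ z v)
        (mfderiv 𝓘(ℝ, EuclideanSpace ℝ (Fin 4)) 𝓘(ℝ, EuclideanSpace ℝ (Fin 4)) Φ z v) := rfl
    rw [h1]
    exact hg _ _ fun h0 ↦ hv ((hΦ' z) (by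
      rw [h0]
      exact ((mfderiv 𝓘(ℝ, EuclideanSpace ℝ (Fin 4)) 𝓘(ℝ, EuclideanSpace ℝ (Fin 4)) Φ
        z).map_zero).symm))
  -- the chart representatives
  set Uk : ℕ → EuclideanSpace ℝ (Fin 4) → ℝ :=
    fun k z ↦ u k ((chartAt (EuclideanSpace ℝ (Fin 4)) c).symm z)
  have hUk : ∀ k, ContDiffOn ℝ ∞ (Uk k) (chartAt (EuclideanSpace ℝ (Fin 4)) c).target := fun k ↦
    contDiffOn_comp_chart_symm (hu k) c Subset.rfl
  have h2top : (2 : WithTop ℕ∞) ≤ ∞ := WithTop.coe_le_coe.mpr le_top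
  have hUk2 : ∀ k (y : U), ContDiffAt ℝ 2 (Uk k) y := fun k y ↦
    (ChartInverseSelf.contDiffAt_comp_symm c (hu k) y.2).of_le h2top
  have hUk4 : ∀ k, ContDiffOn ℝ 4 (Uk k) (chartAt (EuclideanSpace ℝ (Fin 4)) c).target := fun k ↦
    (hUk k).of_le (WithTop.coe_le_coe.mpr le_top)
  have hf : ∀ k, ContMDiff 𝓘(ℝ, EuclideanSpace ℝ (Fin 4)) 𝓘(ℝ) ∞ (u k ∘ Φ) := fun k ↦
    (hu k).comp (hΦ.of_le le_self_add)
  have hfF : ∀ k (y : U), (u k ∘ Φ) y = Uk k y := fun _ _ ↦ rfl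
  -- the Weyl term and the right-hand side in the chart
  set W : EuclideanSpace ℝ (Fin 4) → ℝ :=
    fun z ↦ g.weylNormSq ((chartAt (EuclideanSpace ℝ (Fin 4)) c).symm z)
  have hWy : ∀ y : U, W y = gU.weylNormSq y := fun y ↦
    (g.weylNormSq_comap hpb hΦ hΦ' hdim hg y).symm
  have hW : ContDiffOn ℝ ∞ W (U : Set (EuclideanSpace ℝ (Fin 4))) :=
    contDiffOn_of_eq_weylNormSq gU hG hgUR hWy
  set Q : EuclideanSpace ℝ (Fin 4) → ℝ :=
    fun z ↦ q ((chartAt (EuclideanSpace ℝ (Fin 4)) c).symm z)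
  have hQ : ContDiffOn ℝ ∞ Q (U : Set (EuclideanSpace ℝ (Fin 4))) :=
    contDiffOn_comp_chart_symm hq c Subset.rfl
  -- the fact's hypotheses transported to the chart metric
  have heqU : ∀ k (y : U), backgroundPathOperator gU (s k) (fun z ↦ -(u k ∘ Φ) z) y =
      Q y * Real.exp (-4 * (-(u k ∘ Φ) y)) := fun k y ↦
    (backgroundPathOperator_comap g hpb hΦ hΦ' hdim hg (w := fun m ↦ -u k m) (hu k).neg
      (s k) y).trans (heq k (Φ y))
  have hposU : ∀ k (y : U), 0 < backgroundScalar gU (fun z ↦ -(u k ∘ Φ) z) y := fun k y ↦ by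
    have h := backgroundScalar_comap g hpb hΦ hΦ' hdim hg (w := fun m ↦ -u k m) (hu k).neg y
    exact (hpos k (Φ y)).trans_eq h.symm
  have hfyU : ∀ k (y : U), |(u k ∘ Φ) y| ≤ C := fun k y ↦ (hbd k (Φ y)).1
  have hgradU : ∀ k (y : U), gU.gradSq (u k ∘ Φ) y ≤ C := fun k y ↦
    (gradSq_comap g hpb hΦ hΦ' hdim hg (hu k) y).trans_le (hbd k _).2.1
  have hhessU : ∀ k (y : U), gU.normSq y (gU.hessian (u k ∘ Φ) y) ≤ C := fun k y ↦
    (normSq_hessian_comap g hpb hΦ hΦ' hdim (hu k) y).trans_le (hbd k _).2.2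
  -- the constants: `C ≥ 0`, `q ≥ q₀ > 0`, `|s_k| ≤ T`, `|Ric|² ≤ P²`, `|R| ≤ P`
  have hC0 : 0 ≤ C := (abs_nonneg _).trans (hbd 0 c).1
  obtain ⟨x₀, -, hx₀⟩ :=
    isCompact_univ.exists_isMinOn ⟨c, mem_univ c⟩ hq.continuous.continuousOn
  have hq₀ : 0 < q x₀ := hq0 x₀
  have hqy : ∀ x, q x₀ ≤ q x := fun x ↦ isMinOn_iff.1 hx₀ x (mem_univ x)
  obtain ⟨T, hT⟩ : ∃ T : ℝ, ∀ k, ‖s k‖ ≤ T := by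
    obtain ⟨T, hT⟩ := (Metric.isBounded_range_of_tendsto s hs).exists_norm_le
    exact ⟨T, fun k ↦ hT _ (mem_range_self k)⟩
  have hsT : ∀ k, |s k| ≤ T := fun k ↦ (Real.norm_eq_abs (s k)).symm.trans_le (hT k)
  have hT0 : 0 ≤ T := (abs_nonneg _).trans (hsT 0)
  obtain ⟨P₁, hP₁⟩ := isCompact_univ.exists_bound_of_continuousOn
    (g.contMDiff_normSq_ricci').continuous.continuousOn
  obtain ⟨P₂, hP₂⟩ := isCompact_univ.exists_bound_of_continuousOn
    g.contMDiff_scalarCurvature.continuous.continuousOn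
  set P : ℝ := Real.sqrt P₁ + |P₂|
  have hP0 : 0 ≤ P := by positivity
  have hP₁0 : 0 ≤ P₁ := (norm_nonneg _).trans (hP₁ c (mem_univ c))
  have hP₁P : P₁ ≤ P ^ 2 := by
    calc P₁ = Real.sqrt P₁ ^ 2 := (Real.sq_sqrt hP₁0).symm
      _ ≤ P ^ 2 :=
          pow_le_pow_left₀ (Real.sqrt_nonneg _) (le_add_of_nonneg_right (abs_nonneg _)) 2
  have hRicU : ∀ y : U, gU.normSq y (gU.ricci y) ≤ P ^ 2 := fun y ↦
    (normSq_ricci_comap g hpb hΦ hΦ' hdim y).trans_le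
      (((Real.le_norm_self _).trans (hP₁ (Φ y) (mem_univ _))).trans hP₁P)
  have hn : (2 : ℕ∞ω) ≤ ((⊤ : ℕ∞) : ℕ∞ω) := WithTop.coe_le_coe.mpr le_top
  have hRU : ∀ y : U, |gU.scalarCurvature y| ≤ P := fun y ↦ by
    have h0 : gU.scalarCurvature y = g.scalarCurvature (Φ y) :=
      g.scalarCurvature_comap_cn hpb hΦ hΦ' hdim hn y
    have h1 := hP₂ (Φ y) (mem_univ _)
    rw [Real.norm_eq_abs] at h1
    rw [h0]
    exact h1.trans ((le_abs_self _).trans (le_add_of_nonneg_left (Real.sqrt_nonneg _)))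
  -- the admissibility margin `cm` and the square-root cutoff `ψ`
  set c₀ : ℝ := q x₀ * Real.exp (-4 * C) / 4 with hc₀
  have hc₀0 : 0 < c₀ := by positivity
  set cm : ℝ := min c₀ (Real.sqrt (2 * c₀)) with hcm
  have hcm0 : 0 < cm := lt_min hc₀0 (Real.sqrt_pos.2 (by positivity))
  have hcmc₀ : cm ≤ c₀ := min_le_left _ _
  have hcmτ : cm ≤ Real.sqrt (2 * c₀) := min_le_right _ _
  obtain ⟨ψ, hψ, hψc, -⟩ := exists_smooth_sqrt_cutoff hcm0
  -- the radii
  set yc : EuclideanSpace ℝ (Fin 4) := chartAt (EuclideanSpace ℝ (Fin 4)) c c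
  have hycT : yc ∈ (chartAt (EuclideanSpace ℝ (Fin 4)) c).target :=
    (chartAt (EuclideanSpace ℝ (Fin 4)) c).map_source (mem_chart_source _ c)
  obtain ⟨r₂, hr₂, -, h₂⟩ := chart_iteratedFDeriv_bounds_le_two g hg hu hbd c
  obtain ⟨B₀, hB₀⟩ := h₂ 0 (by norm_num)
  obtain ⟨B₁, hB₁⟩ := h₂ 1 (by norm_num)
  obtain ⟨B₂, hB₂⟩ := h₂ 2 le_rfl
  obtain ⟨r₃, hr₃, hr₃T⟩ := Metric.isOpen_iff.1 (chartAt (EuclideanSpace ℝ (Fin 4)) c).open_target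
    yc hycT
  set R : ℝ := min (r₂ / 2) (r₃ / 2)
  have hR : 0 < R := lt_min (half_pos hr₂) (half_pos hr₃)
  have hRO : closedBall yc R ⊆ (chartAt (EuclideanSpace ℝ (Fin 4)) c).target :=
    (closedBall_subset_closedBall (min_le_right _ _)).trans
      ((closedBall_subset_ball (half_lt_self hr₃)).trans hr₃T)
  have hR₂ : closedBall yc R ⊆ ball yc r₂ :=
    (closedBall_subset_closedBall (min_le_left _ _)).trans
      (closedBall_subset_ball (half_lt_self hr₂))
  -- uniform `C²` bounds of the representatives on the closed ball, one constant `Bm ≥ 0`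
  set Bm : ℝ := max (max B₀ (max B₁ B₂)) 0
  have hBm0 : 0 ≤ Bm := le_max_right _ _
  have hbd' : ∀ k, ∀ y ∈ closedBall yc R, ∀ j ≤ 2, ‖iteratedFDeriv ℝ j (Uk k) y‖ ≤ Bm := by
    intro k y hy j hj
    interval_cases j
    · exact (hB₀ k y (hR₂ hy)).trans ((le_max_left _ _).trans (le_max_left _ _))
    · exact (hB₁ k y (hR₂ hy)).trans
        (((le_max_left _ _).trans (le_max_right _ _)).trans (le_max_left _ _))
    · exact (hB₂ k y (hR₂ hy)).trans
        (((le_max_right _ _).trans (le_max_right _ _)).trans (le_max_left _ _))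
  have hD1 : ∀ k, ∀ y ∈ closedBall yc R, ‖fderiv ℝ (Uk k) y‖ ≤ Bm := fun k y hy ↦ by
    rw [← norm_iteratedFDeriv_one]; exact hbd' k y hy 1 (by norm_num)
  have hD2 : ∀ k, ∀ y ∈ closedBall yc R, ‖fderiv ℝ (fderiv ℝ (Uk k)) y‖ ≤ Bm := fun k y hy ↦ by
    rw [← norm_iteratedFDeriv_one, norm_iteratedFDeriv_fderiv]; exact hbd' k y hy 2 le_rfl
  -- frame constants on the compact ball
  obtain ⟨κ, Λg, hκ, hΛg, hframe⟩ :=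
    exists_frame_bounds gU hG hgUR (isCompact_closedBall yc R) hRO
  -- the Evans–Krylov jet function
  set bE : OrthonormalBasis (Fin 4) ℝ (EuclideanSpace ℝ (Fin 4)) :=
    EuclideanSpace.basisFun (Fin 4) ℝ with hbE
  set F : EuclideanSpace ℝ (Fin 4) × ℝ × CJet (Fin 4) 2 → ℝ := ekOperator G W Q ψ with hFdef
  have hFs : ContDiffOn ℝ ∞ F {x | x.1 ∈ (chartAt (EuclideanSpace ℝ (Fin 4)) c).target} :=
    contDiffOn_ekOperator gU hG hW hQ hψ
  have hF2 : ContDiffOn ℝ 2 F {x | x.1 ∈ (chartAt (EuclideanSpace ℝ (Fin 4)) c).target} :=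
    hFs.of_le h2top
  -- uniform bounds for `DF`, `D²F`, `Σ` on the compact jet set
  obtain ⟨μ, hμ0, hμ⟩ := exists_ekOperator_deriv_bounds gU hG hW hQ hψ
    (isCompact_closedBall yc R) hRO T Bm
  -- the uniform hybrid margin
  obtain ⟨δ₀, hδ₀, hmargin⟩ := exists_hybrid_margin_uniform gU hG hR hRO T Bm Bm hcm0
  -- the ellipticity constants
  set l : ℝ := 4 * (q x₀ * Real.exp (-4 * C) / 4 /
      (2 * (4 * ((1 + T) * P + (3 + 2 * T) * Real.sqrt C + (5 + 2 * T) * C) + 1))) /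
    ((Λg * κ) ^ 2 * 4) / (8 * Real.sqrt (μ + 1)) with hl
  have hl0 : 0 < l := by positivity
  set L : ℝ := 4 * (3 * (4 * ((1 + T) * P + (3 + 2 * T) * Real.sqrt C + (5 + 2 * T) * C) + 1) *
      (2 + T)) * (4 * κ ^ 2) / (8 * Real.sqrt (cm / 2)) with hL
  -- the jets of the representatives
  have hjet : ∀ k, ∀ y ∈ closedBall yc R, ‖cjetOf bE 2 (Uk k) y‖ ≤ Bm := fun k y hy ↦
    norm_cjetOf_le bE 2 (Uk k) y (fun j hj ↦ hbd' k y hy j hj) hBm0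
  -- the equation
  have heqF : ∀ k, ∀ y ∈ (chartAt (EuclideanSpace ℝ (Fin 4)) c).target,
      F (y, s k, cjetOf bE 2 (Uk k) y) = 0 := fun k y hyU ↦
    ekOperator_cjetOf_eq_zero gU hG hgUR ψ (s k) (hf k) (hfF k) ⟨y, hyU⟩ (hUk2 k ⟨y, hyU⟩)
      (hWy ⟨y, hyU⟩) (heqU k ⟨y, hyU⟩)
  -- the margins at the jets of the solutions
  have hSig : ∀ k (y : U), c₀ ≤ 1 / 2 * (mtrAt G y (gvForm G (s k) y (fderiv ℝ (Uk k) y)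
      (fderiv ℝ (fderiv ℝ (Uk k)) y)) ^ 2 - normSqAt G y (gvForm G (s k) y (fderiv ℝ (Uk k) y)
      (fderiv ℝ (fderiv ℝ (Uk k)) y))) := fun k y ↦
    le_sigma2Inv_of_equation gU hG hgUR (s k) (hf k) (hfF k) (q := fun z : U ↦ Q z) hq₀ y
      (hUk2 k y) (hqy _) (heqU k y) (hfyU k y)
  have hτ : ∀ k (y : U), Real.sqrt (2 * c₀) ≤ mtrAt G y (gvForm G (s k) y (fderiv ℝ (Uk k) y)
      (fderiv ℝ (fderiv ℝ (Uk k)) y)) := fun k y ↦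
    sqrt_le_trace_of_equation gU hG hgUR (hs1 k) (hf k) (hfF k) (q := fun z : U ↦ Q z) hq₀ y
      (hUk2 k y) (hqy _) (heqU k y) (hposU k y) (hfyU k y)
  -- ### the hypotheses of the abstract theorem, uniformly in `k`
  have hμ1 : ∀ k, ∀ z ∈ closedBall yc R, ∀ J : CJet (Fin 4) 2, ‖J‖ ≤ Bm →
      ‖fderiv ℝ F (z, s k, J)‖ ≤ μ := fun k z hz J hJ ↦ (hμ (s k) (hsT k) z hz J hJ).1
  have hμ2 : ∀ k, ∀ y ∈ closedBall yc R,
      ‖fderiv ℝ (fderiv ℝ F) (y, s k, cjetOf bE 2 (Uk k) y)‖ ≤ μ := fun k y hy ↦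
    (hμ (s k) (hsT k) y hy _ (hjet k y hy)).2.1
  have hell : ∀ k, ∀ y ∈ closedBall yc R, ∀ ξ : Fin 4 → ℝ,
      l * (ξ ⬝ᵥ ξ) ≤ fderiv ℝ F (y, s k, cjetOf bE 2 (Uk k) y)
        ((0 : EuclideanSpace ℝ (Fin 4)), (0 : ℝ), topJet (fun I ↦ ξ (I 0) * ξ (I 1))) ∧
      fderiv ℝ F (y, s k, cjetOf bE 2 (Uk k) y)
        ((0 : EuclideanSpace ℝ (Fin 4)), (0 : ℝ), topJet (fun I ↦ ξ (I 0) * ξ (I 1))) ≤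
        L * (ξ ⬝ᵥ ξ) := by
    intro k y hy ξ
    have hyU : y ∈ (chartAt (EuclideanSpace ℝ (Fin 4)) c).target := hRO hy
    set y' : U := ⟨y, hyU⟩
    obtain ⟨b, hb⟩ := gU.exists_basis_isOrthonormalFrame (x := y') (fun v hv ↦ hgUR y' v hv) hE
    obtain ⟨hΛy, hκb⟩ := hframe y' hy
    -- `Σ ≤ μ ≤ μ + 1` at the jet
    have hSigle : chartOperator G (s k) 0 y (fderiv ℝ (Uk k) y) (fderiv ℝ (fderiv ℝ (Uk k)) y) / 4 ≤
        μ + 1 := by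
      have h1 := (hμ (s k) (hsT k) y hy _ (hjet k y hy)).2.2
      rw [pOf_cjetOf, rOf_cjetOf bE (hUk2 k y')] at h1
      exact ((le_abs_self _).trans h1).trans (le_add_of_nonneg_right zero_le_one)
    have key := ekOperator_symbol_bounds_of_solution gU hG hgUR hW hQ hψ hψc hcm0 (hf k) (hfF k)
      (q := fun z : U ↦ Q z) (hs1 k) (hsT k) hq₀ hcmc₀ hC0 hP0 y' (hUk2 k y') (hqy _) (heqU k y')
      (hposU k y') (hfyU k y') (hgradU k y') (hhessU k y') (hRicU y') (hRU y') hb hκ.le (hκb hb)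
      hΛy hSigle ξ
    refine ⟨key.1, key.2.trans ?_⟩
    have hξ : 0 ≤ ξ ⬝ᵥ ξ := Finset.sum_nonneg fun i _ ↦ mul_self_nonneg (ξ i)
    refine mul_le_mul_of_nonneg_right ?_ hξ
    rw [hL]
    set Y : ℝ := 4 * ((1 + T) * P + (3 + 2 * T) * Real.sqrt C + (5 + 2 * T) * C) + 1 with hY
    have h3Y : 0 ≤ 3 * Y := by positivity
    have hst : 2 - s k ≤ 2 + T := by linarith only [neg_abs_le (s k), hsT k]
    have hsq : 0 < Real.sqrt (cm / 2) := Real.sqrt_pos.2 (half_pos hcm0)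
    rw [div_le_div_iff_of_pos_right (by positivity)]
    have h1 : 3 * Y * (2 - s k) ≤ 3 * Y * (2 + T) := mul_le_mul_of_nonneg_left hst h3Y
    have h2 : 4 * (3 * Y * (2 - s k)) ≤ 4 * (3 * Y * (2 + T)) :=
      mul_le_mul_of_nonneg_left h1 (by norm_num)
    exact mul_le_mul_of_nonneg_right h2 (by positivity)
  have hlL : l ≤ L := by
    have h1 := hell 0 yc (mem_closedBall_self hR.le) (Pi.single 0 1)
    have hvv : (Pi.single 0 (1 : ℝ) : Fin 4 → ℝ) ⬝ᵥ Pi.single 0 1 = 1 := by simp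
    simp only [hvv, mul_one] at h1
    exact h1.1.trans h1.2
  have hconc : ∀ k, ∀ y ∈ closedBall yc R, ∀ Ω : (Fin 2 → Fin 4) → ℝ,
      (∀ i j, Ω ![i, j] = Ω ![j, i]) →
      fderiv ℝ (fderiv ℝ F) (y, s k, cjetOf bE 2 (Uk k) y)
        ((0 : EuclideanSpace ℝ (Fin 4)), (0 : ℝ), topJet Ω)
        ((0 : EuclideanSpace ℝ (Fin 4)), (0 : ℝ), topJet Ω) ≤ 0 := by
    intro k y hy Ω hΩ
    have hyU : y ∈ (chartAt (EuclideanSpace ℝ (Fin 4)) c).target := hRO hy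
    exact fderiv_fderiv_ekOperator_nonpos_of_solution gU hG hgUR hW hQ hψ hψc hcm0 (hf k) (hfF k)
      (q := fun z : U ↦ Q z) (hs1 k) hq₀ hcmc₀ ⟨y, hyU⟩ (hUk2 k ⟨y, hyU⟩) (hqy _)
      (heqU k ⟨y, hyU⟩) (hposU k ⟨y, hyU⟩) (hfyU k ⟨y, hyU⟩) hΩ
  have hhyb : ∀ k, ∀ x ∈ closedBall yc R, ∀ y ∈ closedBall yc R, dist x y ≤ δ₀ →
      F (y, s k, cjetOf bE 2 (Uk k) y +
          topJet (cjetOf bE 2 (Uk k) x (Fin.last 2) - cjetOf bE 2 (Uk k) y (Fin.last 2))) -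
        F (y, s k, cjetOf bE 2 (Uk k) y) ≤
      fderiv ℝ F (y, s k, cjetOf bE 2 (Uk k) y)
        ((0 : EuclideanSpace ℝ (Fin 4)), (0 : ℝ),
          topJet (cjetOf bE 2 (Uk k) x (Fin.last 2) - cjetOf bE 2 (Uk k) y (Fin.last 2))) := by
    intro k x hx y hy hxy
    have hxU : x ∈ (chartAt (EuclideanSpace ℝ (Fin 4)) c).target := hRO hx
    have hyU : y ∈ (chartAt (EuclideanSpace ℝ (Fin 4)) c).target := hRO hy
    -- the hybrid margins from the uniform `δ₀`
    have hdiff : ∀ z ∈ closedBall yc R, DifferentiableAt ℝ (fderiv ℝ (Uk k)) z := fun z hz ↦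
      (((hUk4 k).fderiv_of_isOpen (m := 3) (chartAt (EuclideanSpace ℝ (Fin 4)) c).open_target
        (by norm_num)).differentiableOn (by norm_num)).differentiableAt
        ((chartAt (EuclideanSpace ℝ (Fin 4)) c).open_target.mem_nhds (hRO hz))
    have hmar := hmargin (s k) (hsT k) (Uk k) hdiff (hD1 k) (hD2 k)
      (fun z hz ↦ ⟨hcmc₀.trans (hSig k ⟨z, hRO hz⟩), hcmτ.trans (hτ k ⟨z, hRO hz⟩)⟩) x hx y hy hxy
    exact ekOperator_hybrid_sub_le_of_solution gU hG hgUR hW hQ hψ hψc hcm0 (hf k) (hfF k)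
      (q := fun z : U ↦ Q z) (hs1 k) hq₀ hcmc₀ ⟨y, hyU⟩ (hUk2 k ⟨y, hyU⟩) (hqy _)
      (heqU k ⟨y, hyU⟩) (hposU k ⟨y, hyU⟩) (hfyU k ⟨y, hyU⟩) ⟨x, hxU⟩ (hUk2 k ⟨x, hxU⟩) hmar.1
      (lt_of_lt_of_le (half_pos hcm0) hmar.2)
  -- ### the abstract Evans–Krylov theorem
  obtain ⟨α, hα0, hα1, B, hEK⟩ := evansKrylov_interior_holder (Fin 4) ℝ hl0 hlL hμ0 hBm0 hR hδ₀
  refine ⟨R / 2, half_pos hR,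
    (ball_subset_ball (half_le_self hR.le)).trans (ball_subset_closedBall.trans hRO),
    α, hα0, hα1, B, fun k ↦ ?_⟩
  exact hEK (chartAt (EuclideanSpace ℝ (Fin 4)) c).open_target (hUk4 k) hF2 (heqF k) hRO
    (hbd' k) (hμ1 k) (hμ2 k) (hell k) (hconc k) (hhyb k)

end Chart

/-! ### The named fact -/

/-- **Gursky–Viaclovsky 2003, Prop. 6 / §5: the solvable set of the Weyl-weighted `σ₂` path is
closed** — the named fact `gurskyViaclovsky_pathClosed_weighted_four` HOLDS: the interior
Evans–Krylov estimate in the charts (`chart_holderOnWith_two`, Gilbarg–Trudinger Thm. 17.14),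
the Schauder bootstrap (`chart_uniform_bounds_of_holderOnWith_two`, Lemma 17.16) and the
Arzelà–Ascoli extraction with the limit argument (`pathClosed_of_chartHigherBounds`), assembled
in `pathClosed_of_chartC2alphaBounds`. [cite: GurskyViaclovsky2003, Prop. 6 and §5] -/
theorem gurskyViaclovsky_pathClosed_weighted_four_holds :
    gurskyViaclovsky_pathClosed_weighted_four :=
  pathClosed_of_chartC2alphaBounds fun _ _ _ _ _ _ _ _ g _ hg _ _ hq hq0 _ _ hs hs1 _ hu heq hpos
    hbd x ↦ chart_holderOnWith_two g hg hq hq0 hs hs1 hu heq hpos hbd x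

end Literature.Geometry.Riemannian.GurskyViaclovskyPath

end
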